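import Summits.BirchSwinnertonDyer.BirchSwinnertonDyer.Theorems.PAdicOrderV2PadicBSDrankOfItems
import Literature.Barriers.BirchSwinnertonDyer.PAdicFunctionalEquationParityTransferProofs

/-!
# Crux #3 `PAdicOrderPadicBSDrankR2` (stmt-BirchSwinnertonDyer-0490) — the `p = 2` residue after PARITY
# (line `Sketch`, skeleton v7, lead c4 — glue file, `--supports stmt-BirchSwinnertonDyer-0490`)

Skeleton v6 (lead c3) reduced the crux, given the three Selmer-side route items
`PAdicOrderMainConjectureR7` (stmt-15426), `PAdicOrderSemisimpleR3` (stmt-0509), `SelmerRankShaPFinite`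
(stmt-0132), to two stubs consumed only at `p = 2`: Kato's Thm 18.4 at `2` from rank `2` on (K) and
"no excess zeros of `L_2(E,T)` in positive rank" (NE2⁺). This file feeds in the tree's parity-free
`p`-adic functional equation in the form of the PARITY TRANSFER
`even_order_padicLFunction_iff_even_order` (Literature, lead c4: the `p`-adic sign is `-ε(f)` at EVERY
good ordinary prime and every level, so `ord_T L_p ≡ ord_T L_q (mod 2)`; no Carayol, no `p ≠ 2`):
under the items `ord_T L_q = rank` at an odd good ordinary `q`, hence

* `padicBSDrank_exists_order_eq_of_items`: at EVERY good ordinary `p` (`2` included)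
  `ord_T L_p(E,T) = m ∈ ℕ` with `m ≡ rank E(ℚ) (mod 2)`;
* `padicBSDrank_two_le_order_of_items`: positive EVEN rank forces `2 ≤ ord_T L_p` (`1 ≤ ord` by the
  level-zero transfer, `+` parity) — at `p = 2` this is the lower bound Kato's theorem gave in rank `2`;
* `padicBSDrank_atTwo_iff_of_items₃`: given the items, the crux at a `2`-ordinary point holds **iff**
  (`3 ≤ rank ⇒ corank Sel_{2^∞} ≤ ord_T L_2`) ∧ (`1 ≤ rank ⇒ ord_T L_2 ≤ corank Sel_{2^∞} + 1`):
  Kato at `2` is needed only from rank `3` on (stub K3), and only an excess of AT LEAST TWO zeros has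
  to be excluded (stub NE2w — an excess of exactly one zero contradicts parity);
* `pAdicOrderPadicBSDrankR2_of_items₃`: the whole crux from the three items + K3 + NE2w (and the
  route-`PAdicOrder` twin), the composition of skeleton v7;
* `stub_padicBSDrank_parity`: the registered provable stub of v7 (= the parity transfer, by name).

References: R. Greenberg, LNM 1716 (1999), §1 pp. 67–68, §5 p. 181; K. Kato, Astérisque 295 (2004),
Thm 18.4; B. Mazur, J. Tate, J. Teitelbaum, Invent. Math. 84 (1986), §I.17, §II.10.
-/

-- D-0017: single-problem summit, so `Summit.BirchSwinnertonDyer.BirchSwinnertonDyer.…` repeats a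
-- namespace BY DESIGN.
set_option linter.dupNamespace false

namespace Summit.BirchSwinnertonDyer.BirchSwinnertonDyer.Theorems

open scoped MatrixGroups ModularForm
open CongruenceSubgroup Literature.NumberTheory.EllipticCurves
  Literature.NumberTheory.EllipticCurves.ModularForms
open Summit.BirchSwinnertonDyer.BirchSwinnertonDyer.Theses.PAdicOrderV2
open Summit.BirchSwinnertonDyer.BirchSwinnertonDyer.Theses.SelmerRank (SelmerRankShaPFinite)

/-- **Stub PT of skeleton v7 (PROVED): parity transfer between good ordinary primes.** For `E/ℚ`
(globally minimal `W`), two good ordinary primes `p, q` (any, `2` included) and the newform `f` of `E`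
(any level): `ord_{T=0} L_p(E,T)` and `ord_{T=0} L_q(E,T)` have the same parity — both are even iff
`ε(f) = -1` (`Literature.Barriers.BirchSwinnertonDyer.even_order_padicLFunction_iff_even_order`).
[cite: GreenbergLNM1716, §5 (p. 181, `λ_E^{anal} = 1` passage)] -/
theorem stub_padicBSDrank_parity :
    ∀ (W : WeierstrassCurve ℚ) [W.IsElliptic] [W.IsGloballyMinimal] (p : ℕ) [Fact p.Prime]
      (q : ℕ) [Fact q.Prime], IsOrdinaryAt W p → IsOrdinaryAt W q →
      ∀ {N : ℕ} [NeZero N] (f : CuspForm (Gamma0 N) 2), IsNewformOf W f →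
      (Even (padicLFunction f (unitRoot W p : ℚ_[p])).order.toNat ↔
        Even (padicLFunction f (unitRoot W q : ℚ_[q])).order.toNat) :=
  fun _ _ _ _ _ _ _ hp hq _ _ _ hf ↦
    Literature.Barriers.BirchSwinnertonDyer.even_order_padicLFunction_iff_even_order hp hq hf

/-- **Under the items, `ord_{T=0} L_p(E,T)` is a natural number with the parity of the rank, at
EVERY good ordinary prime (`p = 2` included).** At an odd good ordinary `q ≥ 5`
(`WeierstrassCurve.exists_good_ordinary_prime_holds`) the items give `ord_T L_q = rank`
(`padicBSDrank_odd_of_items`); transfer the parity to `p` (stub PT `stub_padicBSDrank_parity`;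
finiteness of the order at `p` by Rohrlich, `padicLFunction_ne_zero_holds`).
[cite: GreenbergLNM1716, §5 (p. 181, `λ_E^{anal} = 1` passage)] -/
theorem padicBSDrank_exists_order_eq_of_items (hMC : PAdicOrderMainConjectureR7)
    (hSS : PAdicOrderSemisimpleR3) (hSha : SelmerRankShaPFinite) (W : WeierstrassCurve ℚ)
    [W.IsElliptic] [W.IsGloballyMinimal] (p : ℕ) [Fact p.Prime] (hord : IsOrdinaryAt W p) {N : ℕ}
    [NeZero N] (f : CuspForm (Gamma0 N) 2) (hf : IsNewformOf W f) :
    ∃ m : ℕ, (padicLFunction f (unitRoot W p : ℚ_[p])).order = m ∧ (Even m ↔ Even W.mordellWeilRank) := by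
  obtain ⟨q, hq, h5, hgood, hordq⟩ := WeierstrassCurve.exists_good_ordinary_prime_holds W
  have hq' := padicBSDrank_odd_of_items hMC hSS hSha W q (by omega) ⟨hgood, hordq⟩ f hf
  have h0 : padicLFunction f (unitRoot W p : ℚ_[p]) ≠ 0 := padicLFunction_ne_zero_holds hord hf
  refine ⟨(padicLFunction f (unitRoot W p : ℚ_[p])).order.toNat, (PowerSeries.coe_toNat_order h0).symm, ?_⟩
  rw [stub_padicBSDrank_parity W p q hord ⟨hgood, hordq⟩ f hf, hq']
  simp

/-- **Positive even rank forces `2 ≤ ord_{T=0} L_p(E,T)` at EVERY good ordinary prime (`p = 2`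
included), from the items**: `1 ≤ ord` (`padicBSDrank_one_le_order_of_items`) and `ord ≡ rank ≡ 0
(mod 2)` (`padicBSDrank_exists_order_eq_of_items`). At `p = 2` in rank `2` this replaces Kato's
Thm 18.4. [cite: GreenbergLNM1716, §5 (p. 181, `λ_E^{anal} = 1` passage)] -/
theorem padicBSDrank_two_le_order_of_items (hMC : PAdicOrderMainConjectureR7)
    (hSS : PAdicOrderSemisimpleR3) (hSha : SelmerRankShaPFinite) (W : WeierstrassCurve ℚ)
    [W.IsElliptic] [W.IsGloballyMinimal] (p : ℕ) [Fact p.Prime] (hord : IsOrdinaryAt W p) {N : ℕ}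
    [NeZero N] (f : CuspForm (Gamma0 N) 2) (hf : IsNewformOf W f) (hpos : 1 ≤ W.mordellWeilRank)
    (heven : Even W.mordellWeilRank) :
    2 ≤ (padicLFunction f (unitRoot W p : ℚ_[p])).order := by
  obtain ⟨m, hm, hpar⟩ := padicBSDrank_exists_order_eq_of_items hMC hSS hSha W p hord f hf
  have h1 := padicBSDrank_one_le_order_of_items hMC hSS hSha W p hord f hf hpos
  rw [hm] at h1 ⊢
  have h1' : 1 ≤ m := by exact_mod_cast h1
  obtain ⟨a, ha⟩ := hpar.mpr heven
  have h2 : 2 ≤ m := by omega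
  exact_mod_cast h2

/-- **Given the items, the crux at a `2`-ordinary point is EXACTLY the sandwich
(`3 ≤ rank ⇒ corank Sel_{2^∞} ≤ ord_T L_2`) ∧ (`1 ≤ rank ⇒ ord_T L_2 ≤ corank Sel_{2^∞} + 1`).**
Compared with v6's `padicBSDrank_atTwo_iff_of_items`: the lower clause now starts at rank `3`
(rank `2` is `padicBSDrank_two_le_order_of_items`), and the upper clause tolerates one extra zero
(an excess of exactly one zero contradicts the parity `ord ≡ rank (mod 2)`,
`padicBSDrank_exists_order_eq_of_items`); `corank Sel_{2^∞} = rank` is item 0132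
(`stub_padicBSDrank_rankEqCorankOfShaFinite`), rank `0` is `padicBSDrank_rankZero_of_items`, rank `1`
uses `padicBSDrank_one_le_order_of_items`. The first clause is Kato's Thm 18.4 at `2` for curves of
rank `≥ 3` (stub K3), the second is the OPEN residue NE2w ("no excess PAIR of zeros of `L_2(E,T)` in
positive rank"). [cite: Kato2004Asterisque, Thm. 18.4 (p. 281)] [cite: MazurTateTeitelbaum1986Invent, §II.10] -/
theorem padicBSDrank_atTwo_iff_of_items₃ (hMC : PAdicOrderMainConjectureR7)
    (hSS : PAdicOrderSemisimpleR3) (hSha : SelmerRankShaPFinite) (W : WeierstrassCurve ℚ)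
    [W.IsElliptic] [W.IsGloballyMinimal] (p : ℕ) [Fact p.Prime] (hp2 : p = 2) (hord : IsOrdinaryAt W p)
    {N : ℕ} [NeZero N] (f : CuspForm (Gamma0 N) 2) (hf : IsNewformOf W f) :
    (padicLFunction f (unitRoot W p : ℚ_[p])).order = W.mordellWeilRank ↔
      ((3 ≤ W.mordellWeilRank →
          (W.selmerCorank p : ℕ∞) ≤ (padicLFunction f (unitRoot W p : ℚ_[p])).order) ∧
        (1 ≤ W.mordellWeilRank →
          (padicLFunction f (unitRoot W p : ℚ_[p])).order ≤ (W.selmerCorank p + 1 : ℕ))) := by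
  subst hp2
  have hshaEq : W.selmerCorank 2 = W.mordellWeilRank :=
    stub_padicBSDrank_rankEqCorankOfShaFinite W 2 (hSha W 2)
  rw [hshaEq]
  obtain ⟨m, hm, hpar⟩ := padicBSDrank_exists_order_eq_of_items hMC hSS hSha W 2 hord f hf
  constructor
  · intro h
    refine ⟨fun _ ↦ h.ge, fun _ ↦ ?_⟩
    rw [h]
    exact_mod_cast Nat.le_succ _
  · rintro ⟨hlow, hup⟩
    rcases Nat.eq_zero_or_pos W.mordellWeilRank with h0 | hpos
    · rw [padicBSDrank_rankZero_of_items hMC hSS hSha W 2 hord f hf h0, h0, Nat.cast_zero]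
    · have hup' : m ≤ W.mordellWeilRank + 1 := by
        have h := hup hpos; rw [hm] at h; exact_mod_cast h
      have h1 : 1 ≤ m := by
        have h := padicBSDrank_one_le_order_of_items hMC hSS hSha W 2 hord f hf hpos
        rw [hm] at h; exact_mod_cast h
      -- parity excludes `m = rank + 1`
      have hne : m ≠ W.mordellWeilRank + 1 := by
        rintro rfl
        rcases Nat.even_or_odd W.mordellWeilRank with he | ho
        · obtain ⟨a, ha⟩ := hpar.mpr he; obtain ⟨b, hb⟩ := he; omega
        · have : Even (W.mordellWeilRank + 1) := ho.add_one
          obtain ⟨b, hb⟩ := hpar.mp this; obtain ⟨a, ha⟩ := ho; omega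
      have hle : m ≤ W.mordellWeilRank := by omega
      rw [hm]
      rcases Nat.lt_or_ge W.mordellWeilRank 3 with hlt | h3
      · -- rank 1 or 2: lower bound from `1 ≤ ord` and parity
        have hge : W.mordellWeilRank ≤ m := by
          rcases Nat.even_or_odd W.mordellWeilRank with he | ho
          · obtain ⟨a, ha⟩ := hpar.mpr he; obtain ⟨b, hb⟩ := he; omega
          · obtain ⟨a, ha⟩ := ho; omega
        exact_mod_cast le_antisymm hle hge
      · have hge : (W.mordellWeilRank : ℕ∞) ≤ m := by rw [← hm]; exact hlow h3
        have hge' : W.mordellWeilRank ≤ m := by exact_mod_cast hge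
        exact_mod_cast le_antisymm hle hge'

/-- **The whole crux #3 `PAdicOrderPadicBSDrankR2` from the three route items, Kato's Thm 18.4 at
`2` FOR CURVES OF RANK `≥ 3` (`hK3`, stub K3 of skeleton v7) and the OPEN residue NE2w (`hNE2w`: at
`p = 2` in positive rank, `ord_T L_2 ≤ corank Sel_{2^∞} + 1`).** Odd `p`: `padicBSDrank_odd_of_items`;
`p = 2`: `padicBSDrank_atTwo_iff_of_items₃`. Compared with v6's `pAdicOrderPadicBSDrankR2_of_items`
both `p = 2` hypotheses are strictly weaker (parity transfer from an odd prime, a tree theorem).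
[cite: GreenbergLNM1716, §1 Conj. 1.12–1.13 and p. 65] [cite: Kato2004Asterisque, Thm. 18.4 (p. 281)] -/
theorem pAdicOrderPadicBSDrankR2_of_items₃ (hMC : PAdicOrderMainConjectureR7)
    (hSS : PAdicOrderSemisimpleR3) (hSha : SelmerRankShaPFinite)
    (hK3 : ∀ (W : WeierstrassCurve ℚ) [W.IsElliptic] [W.IsGloballyMinimal] (p : ℕ) [Fact p.Prime],
      p = 2 → IsOrdinaryAt W p → ∀ {N : ℕ} [NeZero N] (f : CuspForm (Gamma0 N) 2), IsNewformOf W f →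
      3 ≤ W.mordellWeilRank →
      (W.selmerCorank p : ℕ∞) ≤ (padicLFunction f (unitRoot W p : ℚ_[p])).order)
    (hNE2w : ∀ (W : WeierstrassCurve ℚ) [W.IsElliptic] [W.IsGloballyMinimal] (p : ℕ) [Fact p.Prime],
      p = 2 → IsOrdinaryAt W p → ∀ {N : ℕ} [NeZero N] (f : CuspForm (Gamma0 N) 2), IsNewformOf W f →
      1 ≤ W.mordellWeilRank →
      (padicLFunction f (unitRoot W p : ℚ_[p])).order ≤ (W.selmerCorank p + 1 : ℕ)) :
    PAdicOrderPadicBSDrankR2 := by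
  intro W _ _ p _ hord N _ f hf
  by_cases hp2 : p = 2
  · exact (padicBSDrank_atTwo_iff_of_items₃ hMC hSS hSha W p hp2 hord f hf).mpr
      ⟨hK3 W p hp2 hord f hf, hNE2w W p hp2 hord f hf⟩
  · exact padicBSDrank_odd_of_items hMC hSS hSha W p hp2 hord f hf

/-- **The whole crux #3, route-`PAdicOrder` spelling**, from the same items and hypotheses as
`pAdicOrderPadicBSDrankR2_of_items₃` (byte-identical bodies, `Iff.rfl`).
[cite: GreenbergLNM1716, §1 Conj. 1.12–1.13 and p. 65] -/
theorem pAdicOrderPadicBSDrankR2_of_items₃' (hMC : PAdicOrderMainConjectureR7)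
    (hSS : Theses.PAdicOrder.PAdicOrderSemisimpleR3) (hSha : SelmerRankShaPFinite)
    (hK3 : ∀ (W : WeierstrassCurve ℚ) [W.IsElliptic] [W.IsGloballyMinimal] (p : ℕ) [Fact p.Prime],
      p = 2 → IsOrdinaryAt W p → ∀ {N : ℕ} [NeZero N] (f : CuspForm (Gamma0 N) 2), IsNewformOf W f →
      3 ≤ W.mordellWeilRank →
      (W.selmerCorank p : ℕ∞) ≤ (padicLFunction f (unitRoot W p : ℚ_[p])).order)
    (hNE2w : ∀ (W : WeierstrassCurve ℚ) [W.IsElliptic] [W.IsGloballyMinimal] (p : ℕ) [Fact p.Prime],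
      p = 2 → IsOrdinaryAt W p → ∀ {N : ℕ} [NeZero N] (f : CuspForm (Gamma0 N) 2), IsNewformOf W f →
      1 ≤ W.mordellWeilRank →
      (padicLFunction f (unitRoot W p : ℚ_[p])).order ≤ (W.selmerCorank p + 1 : ℕ)) :
    Theses.PAdicOrder.PAdicOrderPadicBSDrankR2 :=
  (Iff.rfl : Theses.PAdicOrder.PAdicOrderPadicBSDrankR2 ↔ PAdicOrderPadicBSDrankR2).mpr
    (pAdicOrderPadicBSDrankR2_of_items₃ hMC
      ((Iff.rfl : Theses.PAdicOrder.PAdicOrderSemisimpleR3 ↔ PAdicOrderSemisimpleR3).mp hSS) hSha hK3 hNE2w)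

end Summit.BirchSwinnertonDyer.BirchSwinnertonDyer.Theorems
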